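import Literature.Geometry.Manifold.KondoTanakaImmersion
import Literature.Geometry.Manifold.LipschitzClarkeRegularCharts
import HarnessLib

/-!
# Kondo–Tanaka smoothing: near every point the projected smoothed map is an injective local
# diffeomorphism, uniformly in the smoothing parameter

Topic `Geometry/Manifold`; namespace `Literature.Geometry.Manifold`. Sixth proof layer under the
named fact `Literature.Geometry.Manifold.KondoTanakaRecognition` (Kondo–Tanaka 2017, Cor. 1.10).
Setting (trivial model `𝓘(ℝ, E)` on a finite-dimensional inner product space `E`): `h : M → N`
continuous, locally Lipschitz in charts and without Clarke-singular points in charts; `e : N → V`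
of class `C^∞` into a finite-dimensional inner product space; an open `T ⊆ V` and a map
`r : V → N` of class `C^∞` on `T` with `e y ∈ T`, `r (e y) = y` (the normal retraction); a patch
system `P` on `M` and globally Lipschitz `gₚ` agreeing with `e ∘ h ∘ κₚ⁻¹` on `B(0, 3rₚ)`; the
smoothed maps `F_ε = Σₚ ρₚ • (J_ε gₚ) ∘ κₚ` and `f_ε = r ∘ F_ε`.

* `contDiffOn_patchSmooth_comp_inv` — the chart expression `F_ε ∘ κ_q⁻¹` is `C^∞` on the target;
* `exists_nhds_isLocalDiffeomorphAt_injOn` — **the pointwise package** (Kondo–Tanaka, proof of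
  Thm. 1.3 and Example 1.8): every `q₀ ∈ M` has an open neighbourhood `W` and an `ε₀ > 0` such
  that for all `0 < ε < ε₀`: `F_ε(W) ⊆ T`, `f_ε` is a `C^∞` local diffeomorphism at every point of
  `W` (tree's chart-level inverse function theorem `isLocalDiffeomorphAt_of_hasFDerivAt_charts`,
  the derivative of the chart expression lying in the uniformly invertible set
  `(∂(ψ ∘ h ∘ κⱼ⁻¹)(κⱼ q₀))_μ` by `KondoTanakaImmersion`), and `f_ε` is injective on `W` (Clarke's
  increase estimate `norm_sub_le_of_fderiv_mem` on a ball of FIXED radius — the convexity in the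
  definition of the generalised Jacobian makes the injectivity radius independent of `ε`).

Everything here is proved; no definitions, no named facts.

## References

* K. Kondo, M. Tanaka, *Approximations of Lipschitz maps via immersions and differentiable exotic
  sphere theorems*, Nonlinear Anal. 155 (2017) 219–249 (arXiv:1408.6036), Example 1.8, proof of
  Thm. 1.3 (p. 13), Cor. 1.10. [KondoTanaka2017]
* F. H. Clarke, *On the inverse function theorem*, Pacific J. Math. 64 (1976), Lemma 3 and Thm. 1.
  [Clarke1976]
-/

noncomputable section

open scoped Manifold ContDiff Topology NNReal
open Set Function Filter Metric
open Literature.Analysis.Convolution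

namespace Literature.Geometry.Manifold

namespace PatchSystem

variable {E : Type*} [NormedAddCommGroup E] [InnerProductSpace ℝ E] [FiniteDimensional ℝ E]
  [MeasurableSpace E] [BorelSpace E]
  {M : Type*} [TopologicalSpace M] [ChartedSpace E M] [IsManifold 𝓘(ℝ, E) ∞ M] [T2Space M]
  {N : Type*} [TopologicalSpace N] [ChartedSpace E N] [IsManifold 𝓘(ℝ, E) ∞ N]
  {V : Type*} [NormedAddCommGroup V] [InnerProductSpace ℝ V] [FiniteDimensional ℝ V]
  [MeasurableSpace V] [BorelSpace V]
  {ι : Type*} [Fintype ι]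

omit [MeasurableSpace V] [BorelSpace V] [T2Space M] in
/-- The chart expression `F_ε ∘ κ_q⁻¹` of the smoothed map is `C^∞` on the target of `κ_q`.
[cite: KondoTanaka2017, Definition 2.15] -/
theorem contDiffOn_patchSmooth_comp_inv [T2Space M] (P : PatchSystem 𝓘(ℝ, E) M E ι)
    (g : ι → E → V) (hg : ∀ p, Continuous (g p)) (ε : ℝ) (q : ι) :
    ContDiffOn ℝ ∞ ((fun x => ∑ p, P.rho p x • mollify ε (g p) ((P.chart p).map x)) ∘
      (P.chart q).inv) (P.chart q).target := by
  have heq : ((fun x => ∑ p, P.rho p x • mollify ε (g p) ((P.chart p).map x)) ∘ (P.chart q).inv) =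
      fun u => ∑ p, ((fun x => P.rho p x • mollify ε (g p) ((P.chart p).map x)) ∘
        (P.chart q).inv) u := by
    funext u; simp only [comp_apply]
  rw [heq]
  exact ContDiffOn.sum fun p _ => P.contDiffOn_rho_smul_comp_inv p q
    (contDiff_mollify ε (hg p).locallyIntegrable)

/-- **The pointwise package of the Kondo–Tanaka recognition theorem.** In the setting of the
module docstring, every `q₀ ∈ M` has an open neighbourhood `W` and an `ε₀ > 0` such that for all
`ε ∈ (0, ε₀)`: the smoothed map `F_ε` sends `W` into the tube `T`; `f_ε = r ∘ F_ε` is a `C^∞`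
local diffeomorphism at every point of `W`; and `f_ε` is injective on `W`.
[cite: KondoTanaka2017, Corollary 1.10] -/
theorem exists_nhds_isLocalDiffeomorphAt_injOn {h : M → N}
    (hL : LocallyLipschitzInCharts 𝓘(ℝ, E) 𝓘(ℝ, E) h)
    (hR : ClarkeRegularInCharts 𝓘(ℝ, E) 𝓘(ℝ, E) h) {e : N → V}
    {T : Set V} (hT : IsOpen T) {r : V → N} (hr : ContMDiffOn 𝓘(ℝ, V) 𝓘(ℝ, E) ∞ r T)
    (hre : ∀ y, e y ∈ T ∧ r (e y) = y) (P : PatchSystem 𝓘(ℝ, E) M E ι) {g : ι → E → V}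
    {L : ι → ℝ≥0} (hg : ∀ p, LipschitzWith (L p) (g p))
    (hgF : ∀ p, EqOn (g p) ((e ∘ h) ∘ (P.chart p).inv) (ball 0 (3 * P.r p))) (q₀ : M) :
    ∃ W : Set M, IsOpen W ∧ q₀ ∈ W ∧ ∃ ε₀ > (0 : ℝ), ∀ ε ∈ Ioo (0 : ℝ) ε₀,
      (∀ q ∈ W, (∑ p, P.rho p q • mollify ε (g p) ((P.chart p).map q)) ∈ T) ∧
      (∀ q ∈ W, IsLocalDiffeomorphAt 𝓘(ℝ, E) 𝓘(ℝ, E) ∞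
        (r ∘ fun x => ∑ p, P.rho p x • mollify ε (g p) ((P.chart p).map x)) q) ∧
      InjOn (r ∘ fun x => ∑ p, P.rho p x • mollify ε (g p) ((P.chart p).map x)) W := by
  haveI : CompleteSpace E := FiniteDimensional.complete ℝ E
  obtain ⟨j, hq₀j, hu₀r⟩ := P.cover q₀
  set κ := P.chart j with hκ
  set u₀ : E := κ.map q₀ with hu₀def
  have hu₀ : u₀ ∈ ball (0 : E) (2 * P.r j) := ball_subset_ball (by linarith [P.r_pos j]) hu₀r
  have hu₀t : u₀ ∈ κ.target := κ.map_mem_target hq₀j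
  have hinv : κ.inv u₀ = q₀ := κ.inv_map hq₀j
  set ψ := extChartAt 𝓘(ℝ, E) (h q₀) with hψ
  set Φ : V → E := ψ ∘ r with hΦdef
  -- the domain where `Φ` is the chart expression of `r`
  set U : Set V := T ∩ r ⁻¹' (chartAt E (h q₀)).source with hU
  have hUo : IsOpen U := hr.continuousOn.isOpen_inter_preimage hT (chartAt E (h q₀)).open_source
  have hFq₀ : ((e ∘ h) ∘ κ.inv) u₀ = e (h q₀) := by simp only [comp_apply, hinv]
  have hy₀U : e (h q₀) ∈ U := ⟨(hre _).1, by
    rw [mem_preimage, (hre _).2]; exact mem_chart_source E (h q₀)⟩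
  have hΦs : ContDiffOn ℝ ∞ Φ U := by
    rw [← contMDiffOn_iff_contDiffOn]
    exact (contMDiffOn_extChartAt (I := 𝓘(ℝ, E)) (n := ∞) (x := h q₀)).comp
      (hr.mono inter_subset_left) fun y hy => hy.2
  have hΦd : ∀ᶠ y in 𝓝 ((e ∘ h) q₀), HasFDerivAt Φ (fderiv ℝ Φ y) y := by
    filter_upwards [hUo.mem_nhds hy₀U] with y hy
    exact ((hΦs.contDiffAt (hUo.mem_nhds hy)).differentiableAt (by simp)).hasFDerivAt
  have hΦ'c : ContinuousAt (fderiv ℝ Φ) ((e ∘ h) q₀) :=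
    (hΦs.continuousOn_fderiv_of_isOpen hUo (by simp)).continuousAt (hUo.mem_nhds hy₀U)
  -- the regular set `J` and its uniformly invertible neighbourhood
  set J : Set (E →L[ℝ] E) := clarkeJacobian (ψ ∘ h ∘ κ.inv) u₀ with hJ
  have hJc : IsCompact J := isCompact_clarkeJacobian_framedChart hL κ hq₀j
  have hJinv : ∀ A ∈ J, A.IsInvertible := fun A hA =>
    isInvertible_of_mem_clarkeJacobian_framedChart hL hR κ hq₀j hA
  obtain ⟨μ, hμ, c, hc, hbb⟩ := exists_bound_below_of_isCompact hJc fun A hA => (hJinv A hA).injective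
  set 𝒥 : Set (E →L[ℝ] E) := cthickening μ J with h𝒥
  have h𝒥c : IsCompact 𝒥 := hJc.cthickening
  have h𝒥conv : Convex ℝ 𝒥 := (convex_clarkeJacobian (f := ψ ∘ h ∘ κ.inv) (x := u₀)).cthickening μ
  -- the left chain rule: `DΦ(e h q₀) ∘ ∂gⱼ(u₀) ⊆ J`
  have hGloc : ((e ∘ h) ∘ κ.inv) =ᶠ[𝓝 u₀] g j := by
    have hu₀3 : u₀ ∈ ball (0 : E) (3 * P.r j) := ball_subset_ball (by linarith [P.r_pos j]) hu₀
    filter_upwards [isOpen_ball.mem_nhds hu₀3] with u hu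
    exact (hgF j hu).symm
  have hincl : (fun A : E →L[ℝ] V => (fderiv ℝ Φ ((e ∘ h) q₀)).comp A) '' clarkeJacobian (g j) u₀ ⊆ J := by
    have hGc : ContinuousAt ((e ∘ h) ∘ κ.inv) u₀ :=
      ((hg j).continuous.continuousAt).congr hGloc.symm
    have hΦd' : ∀ᶠ y in 𝓝 (((e ∘ h) ∘ κ.inv) u₀), HasFDerivAt Φ (fderiv ℝ Φ y) y := by
      rw [hFq₀]; exact hΦd
    have hΦ'c' : ContinuousAt (fderiv ℝ Φ) (((e ∘ h) ∘ κ.inv) u₀) := by rw [hFq₀]; exact hΦ'c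
    have h1 := image_clarkeJacobian_comp_left_subset hΦd' hΦ'c' hGc
    have hcompeq : Φ ∘ ((e ∘ h) ∘ κ.inv) = ψ ∘ h ∘ κ.inv := by
      funext u; simp only [comp_apply, hΦdef, (hre _).2]
    rw [hcompeq, hFq₀, clarkeJacobian_congr hGloc] at h1
    exact h1
  -- layer D and the convergence in the chart
  have hD := P.eventually_hasFDerivAt_comp_patchSmooth_mem (F := e ∘ h) hg hgF hq₀j hu₀ hΦd hΦ'c hμ
  have hinU := (P.tendsto_patchSmooth_comp_inv (F := e ∘ h) hg hgF hq₀j hu₀).eventually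
    (hUo.mem_nhds hy₀U)
  have htarget : ∀ᶠ pr : ℝ × E in (𝓝[>] (0 : ℝ)) ×ˢ 𝓝 u₀, pr.2 ∈ κ.target :=
    (eventually_mem_set.2 (κ.isOpen_target.mem_nhds hu₀t)).prod_inr _
  obtain ⟨pa, hpa, pb, hpb, hboth⟩ := eventually_prod_iff.1 ((hD.and hinU).and htarget)
  obtain ⟨ε₀, hε₀, hε⟩ := (nhdsGT_basis (0 : ℝ)).eventually_iff.1 hpa
  obtain ⟨δ, hδ, hδb⟩ := Metric.eventually_nhds_iff_ball.1 hpb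
  -- the neighbourhood `W`
  set W : Set M := κ.source ∩ κ.map ⁻¹' ball u₀ δ with hW
  have hWo : IsOpen W := κ.isOpen_source_inter_preimage isOpen_ball
  have hq₀W : q₀ ∈ W := ⟨hq₀j, mem_ball_self hδ⟩
  refine ⟨W, hWo, hq₀W, ε₀, hε₀, fun ε hεI => ?_⟩
  have hpaε : pa ε := hε hεI
  -- notation for the smoothed map and its chart expression
  set S : M → V := fun x => ∑ p, P.rho p x • mollify ε (g p) ((P.chart p).map x) with hS
  set SΦ : E → E := Φ ∘ S ∘ κ.inv with hSΦ
  -- the key facts at the points of `ball u₀ δ`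
  have key : ∀ u ∈ ball u₀ δ, (∃ D : E →L[ℝ] E, HasFDerivAt SΦ D u ∧ D ∈ 𝒥) ∧
      S (κ.inv u) ∈ U ∧ u ∈ κ.target := by
    intro u hu
    obtain ⟨⟨⟨D, hD1, hD2⟩, hU1⟩, ht⟩ := hboth hpaε (hδb u hu)
    exact ⟨⟨D, hD1, cthickening_subset_of_subset μ hincl hD2⟩, hU1, ht⟩
  -- (1) `F_ε(W) ⊆ T`
  have hWT : ∀ q ∈ W, S q ∈ T := by
    intro q hq
    have h1 := (key (κ.map q) hq.2).2.1
    rw [κ.inv_map hq.1] at h1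
    exact h1.1
  -- smoothness of `f_ε` on `W`
  have hSsmooth : ContMDiff 𝓘(ℝ, E) 𝓘(ℝ, V) ∞ S :=
    P.contMDiff_patchSmooth g (fun p => (hg p).continuous) ε
  have hfW : ContMDiffOn 𝓘(ℝ, E) 𝓘(ℝ, E) ∞ (r ∘ S) W :=
    hr.comp hSsmooth.contMDiffOn fun q hq => hWT q hq
  -- the derivative of the chart expression is `fderiv SΦ`, valued in `𝒥`, on the ball
  have hderiv : ∀ u ∈ ball u₀ δ, HasFDerivAt SΦ (fderiv ℝ SΦ u) u ∧ fderiv ℝ SΦ u ∈ 𝒥 := by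
    intro u hu
    obtain ⟨⟨D, hD1, hD2⟩, -, -⟩ := key u hu
    rw [hD1.fderiv]
    exact ⟨hD1, hD2⟩
  refine ⟨hWT, fun q hq => ?_, ?_⟩
  · -- (2) local diffeomorphism at `q ∈ W`
    set u : E := κ.map q with hudef
    have hu : u ∈ ball u₀ δ := hq.2
    obtain ⟨⟨D, hD1, hD2⟩, hSU, hut⟩ := key u hu
    have hDinv : D.IsInvertible := isInvertible_of_bound_below hc (hbb D hD2)
    -- the chart expression through `chartAt E κ.z` is `SΦ ∘ κ.affine`
    have haff : κ.affine (chartAt E κ.z q) = u := by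
      simp [hudef, FramedChart.affine_apply, FramedChart.map_apply]
    have hcomp : HasFDerivAt (SΦ ∘ κ.affine) (D.comp (κ.A : E →L[ℝ] E)) (chartAt E κ.z q) := by
      refine HasFDerivAt.comp _ ?_ (κ.hasFDerivAt_affine _)
      rw [haff]; exact hD1
    obtain ⟨Lq, hLq⟩ := hDinv.comp (ContinuousLinearMap.isInvertible_equiv (f := κ.A))
    have hexpr : (chartAt E (h q₀)) ∘ (r ∘ S) ∘ (chartAt E κ.z).symm = SΦ ∘ κ.affine := by
      funext v
      simp only [comp_apply, hSΦ, hΦdef, hψ, FramedChart.inv_affine, extChartAt_coe,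
        extChartAt_coe_symm, modelWithCornersSelf_coe, modelWithCornersSelf_coe_symm, id_eq,
        CompTriple.comp_eq]
    have hqsrc : q ∈ (chartAt E κ.z).source := by
      have h1 : q ∈ κ.source := hq.1
      rwa [FramedChart.source_eq, extChartAt_source] at h1
    have hfq : (r ∘ S) q ∈ (chartAt E (h q₀)).source := by
      have h1 := hSU
      rw [κ.inv_map hq.1] at h1
      exact h1.2
    refine isLocalDiffeomorphAt_of_hasFDerivAt_charts (n := ∞) (by simp) hWo hq hfW
      (IsManifold.chart_mem_maximalAtlas κ.z) (IsManifold.chart_mem_maximalAtlas (h q₀)) hqsrc hfq (L := Lq) ?_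
    rw [hexpr, hLq]
    exact hcomp
  · -- (3) injectivity on `W`
    have hball_t : ball u₀ δ ⊆ κ.target := fun u hu => (key u hu).2.2
    have hSΦs : ContDiffOn ℝ ∞ SΦ (ball u₀ δ) := by
      have h1 : ContDiffOn ℝ ∞ (S ∘ κ.inv) (ball u₀ δ) :=
        (P.contDiffOn_patchSmooth_comp_inv g (fun p => (hg p).continuous) ε j).mono hball_t
      exact hΦs.comp h1 fun u hu => (key u hu).2.1
    have hf'c : ContinuousOn (fderiv ℝ SΦ) (ball u₀ δ) :=
      hSΦs.continuousOn_fderiv_of_isOpen isOpen_ball (by simp)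
    have hest : ∀ a ∈ ball u₀ δ, ∀ b ∈ ball u₀ δ, c * ‖b - a‖ ≤ ‖SΦ b - SΦ a‖ := fun a ha b hb =>
      norm_sub_le_of_fderiv_mem (convex_ball u₀ δ) h𝒥conv h𝒥c hbb (fun u hu => (hderiv u hu).1)
        hf'c (fun u hu => (hderiv u hu).2) ha hb
    intro q hq q' hq' hqq'
    have h1 : SΦ (κ.map q) = SΦ (κ.map q') := by
      simp only [hSΦ, comp_apply, κ.inv_map hq.1, κ.inv_map hq'.1]
      exact congrArg ψ hqq'
    have h2 : c * ‖κ.map q' - κ.map q‖ ≤ 0 := by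
      have h := hest _ hq.2 _ hq'.2
      rwa [h1, sub_self, norm_zero] at h
    have h3 : κ.map q' = κ.map q := by
      have h4 : ‖κ.map q' - κ.map q‖ ≤ 0 := by
        by_contra hlt
        exact absurd h2 (not_le.2 (mul_pos hc (lt_of_not_ge hlt)))
      exact sub_eq_zero.1 (norm_le_zero_iff.1 h4)
    exact κ.injOn_map hq.1 hq'.1 h3.symm

end PatchSystem

end Literature.Geometry.Manifold

end
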